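import Summits.NavierStokesRegularity.NavierStokesRegularity.Theorems.TypeILiouvilleTypeIliouvilleNoTypeIIEternalEnergyLiouvilleLineInvariant
import Literature.Analysis.FluidPDE.KNSSThm53OfWindow
import HarnessLib

/-!
# EEL′ on the axisymmetric-with-swirl stratum under KNSS's `C/r` bound, unconditionally (crux
# `TypeIliouvilleNoTypeII`, stmt-NavierStokesRegularity-0056; rigidity residual EEL′ of the
# pressure-free eternal split)

Helper file (theorems only).  KNSS's Theorem 5.3 — an axisymmetric bounded weak solution in
`ℝ³ × (-∞, 0)` with `|u(x, t)| ≤ C/√(x₁² + x₂²)` vanishes — is a THEOREM of the tree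
(`KNSS2009_liouville_bound_C_over_r_holds`, all of §4, Lemma 2.1, (5.10)–(5.20) and Thm 5.2 proved).
Consequence for the EEL′ class (bounded eternal Oseen-mild smooth divergence-free fields), with NO use
of the energy bounds:

* `axisym_C_over_r_eq_zero` — an axisymmetric member WITH swirl allowed, satisfying
  `cylRadius x · ‖v(t, x)‖ ≤ C`, is identically zero (time translates are bounded ancient mild, hence
  bounded weak, solutions — `ImmortalZoom.isBoundedAncientMildSolution_translate`; Thm 5.3 gives
  `v(t) = 0` a.e. for a.e. `t`; joint continuity upgrades to everywhere, `eq_zero_of_ae_Iio_of_continuous`);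
* `eternalLiouvillePressureFree_axisym_C_over_r` — EEL′ in the exact `hEEL` shape on this stratum.

With `…EternalEnergyLiouvilleAxisym.lean` (no swirl, Thm 5.2) the axisymmetric part of the open core of
EEL′ consists of SWIRLING profiles violating the `C/r` bound.  WHAT THIS IS NOT: not NS; EEL′ stays
OPEN. [folklore]
-/

noncomputable section

-- the summit and its single problem share the name `NavierStokesRegularity` (D-0017 nested layout)
set_option linter.dupNamespace false

open Set Function Filter Topology MeasureTheory Metric
open scoped NNReal ENNReal

namespace Summit.NavierStokesRegularity.NavierStokesRegularity.Theorems.TypeIliouvilleNoTypeII.TypeIIZoom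

open Literature.Analysis Literature.Analysis.FluidPDE
open Summit.NavierStokesRegularity.NavierStokesRegularity.Theorems.TypeIliouvilleNoTypeII.ImmortalZoom
  (isBoundedAncientMildSolution_translate)

variable {v : ℝ → EuclideanSpace ℝ (Fin 3) → EuclideanSpace ℝ (Fin 3)}

/-- **KNSS Thm 5.3 on the eternal profile.**  A bounded eternal Oseen-mild smooth divergence-free
field which is axisymmetric about the `x₃`-axis (swirl allowed) and satisfies
`cylRadius x · ‖v(t, x)‖ ≤ C` everywhere is identically zero. [cite: KochNadirashviliSereginSverak2009, Thm 5.3 (arXiv:0709.3599 p. 10)] -/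
theorem axisym_C_over_r_eq_zero (hv : ContDiff ℝ (⊤ : ℕ∞) (uncurry v))
    (hdiv : ∀ t, VectorCalculus.IsDivFree (v t))
    (hmild : ∀ s t : ℝ, s < t → ∀ x, v t x = heatFlow (v s) (t - s) x - oseenDuhamel 1 s v v t x)
    (hbdd : ∃ C : ℝ, ∀ t x, ‖v t x‖ ≤ C) (haxi : ∀ t, IsAxisymmetric (v t))
    (hdecay : ∃ C : ℝ, ∀ (t : ℝ) (x : EuclideanSpace ℝ (Fin 3)), cylRadius x * ‖v t x‖ ≤ C)
    (t : ℝ) (x : EuclideanSpace ℝ (Fin 3)) : v t x = 0 := by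
  have hcont3 : Continuous (uncurry v) := hv.continuous
  have hslice : ∀ τ, Continuous (v τ) := fun τ => hcont3.comp (Continuous.prodMk_right τ)
  -- the translate `w(s) = v(s + (t + 1))`
  set T : ℝ := t + 1 with hT
  set w : ℝ → EuclideanSpace ℝ (Fin 3) → EuclideanSpace ℝ (Fin 3) := fun s => v (s + T) with hw
  have hwcont : Continuous (uncurry w) :=
    hcont3.comp ((continuous_fst.add continuous_const).prodMk continuous_snd)
  have hanc : IsBoundedAncientMildSolution 1 w :=
    isBoundedAncientMildSolution_translate v hv hdiv hmild hbdd T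
  have hweak : IsBoundedWeakNSSolutionOn (Iio 0) isOpen_Iio 1 w :=
    hanc.isBoundedWeakNSSolutionOn one_pos hwcont.aestronglyMeasurable.restrict
      fun s _ => (hslice (s + T)).aestronglyMeasurable
  -- KNSS Thm 5.3
  obtain ⟨C, hC⟩ := hdecay
  have hae := KNSS2009_liouville_bound_C_over_r.of_pointwise KNSS2009_liouville_bound_C_over_r_holds
    hweak (fun s _ => haxi (s + T)) ⟨C, fun s _ y => hC (s + T) y⟩
  -- a.e. slice vanishes everywhere (continuity in `y`), then every slice (continuity in `s`)
  have hae' : ∀ᵐ s ∂(volume.restrict (Iio (0 : ℝ))), w s x = 0 := by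
    filter_upwards [hae] with s hs
    have h := ((hslice (s + T)).ae_eq_iff_eq volume continuous_const).1 hs
    exact congrFun h x
  have hcs : Continuous fun s => w s x := hwcont.comp (continuous_id.prodMk continuous_const)
  have h1 := eq_zero_of_ae_Iio_of_continuous hcs hae' (by norm_num : (-1 : ℝ) < 0)
  have hwx : w (-1) x = v t x := by simp only [hw, hT]; congr 1; ring
  rwa [hwx] at h1

variable (v) in
/-- **EEL′ holds on the axisymmetric `C/r` stratum** — in the exact hypothesis shape of
`EternalSplit.typeIliouvilleNoTypeII_of_pressureFreeSlab_of_eternalLiouville` (`hEEL`), restricted to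
profiles that are axisymmetric about the `x₃`-axis (swirl allowed) with `cylRadius x · ‖v(t, x)‖ ≤ C`.
Unconditional (KNSS Thm 5.3 is a tree theorem); the energy clauses are not used. [cite: KochNadirashviliSereginSverak2009, Thm 5.3 (arXiv:0709.3599 p. 10)] -/
theorem eternalLiouvillePressureFree_axisym_C_over_r
    (hv : ContDiff ℝ (⊤ : ℕ∞) (uncurry v)) (hdiv : ∀ t, VectorCalculus.IsDivFree (v t))
    (hmild : ∀ s t : ℝ, s < t → ∀ x, v t x = heatFlow (v s) (t - s) x - oseenDuhamel 1 s v v t x)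
    (hbd : ∀ (t : ℝ) (x : EuclideanSpace ℝ (Fin 3)), ‖v t x‖ ≤ 2)
    (_hI : ∃ I : ℝ≥0∞, I ≠ ⊤ ∧ ∀ r : ℝ, 0 < r → ∀ z : ℝ × EuclideanSpace ℝ (Fin 3),
      cknAEss r z v ≤ I ∧ cknC r z v ≤ I ∧ cknE r z (fun s y => fderiv ℝ (v s) y) ≤ I)
    (haxi : ∀ t, IsAxisymmetric (v t))
    (hdecay : ∃ C : ℝ, ∀ (t : ℝ) (x : EuclideanSpace ℝ (Fin 3)), cylRadius x * ‖v t x‖ ≤ C) :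
    v 0 0 = 0 :=
  axisym_C_over_r_eq_zero hv hdiv hmild ⟨2, hbd⟩ haxi hdecay 0 0

end Summit.NavierStokesRegularity.NavierStokesRegularity.Theorems.TypeIliouvilleNoTypeII.TypeIIZoom

end
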